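import Summits.BirchSwinnertonDyer.BirchSwinnertonDyer.Theorems.AdditiveKolyvaginRoadManinFrameResidueProperROfKatoFacts
import Summits.BirchSwinnertonDyer.BirchSwinnertonDyer.Theorems.EdixhovenFibreFiveSevenNonEisensteinWitness
import HarnessLib

/-!
# Route `AdditiveKolyvaginRoad`, crux `ManinFrameResidueProperR` (stmt-BirchSwinnertonDyer-20709), line
# `tame_twist`: the crux BY NAME from F″ (Kato) and the three-copy Ihara lemma ONLY (`--supports`, CONDITIONAL)

Cell `pub/bsd-wall`, seat `bsd-wall-manin-p1` (g6). THEOREMS ONLY (no definition, no named fact, no `sorry`).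
Nothing is closed unconditionally and BSD is not proved by this file.

`maninFrameResidueProperR_of_kato_of_iharaSq_of_witness` (this seat, p592227) is `F″ → Ihara³ → hW → ManinFrameResidueProperR`
with `hW` the Chebotarev non-Eisenstein witness (for `E[p]` irreducible, `p` odd, `S ≠ 0`: a prime `r₀ ∤ S`,
`r₀ ≡ 1 (mod S)`, `a_{r₀}(E) ≢ r₀ + 1 (mod p)`). That witness is now the THEOREM
`NonEisensteinWitness.lTwistWitness` of the sibling line `EdixhovenFibreFiveSeven` (seat `bsd-line-edix-p5`; Chebotarev
via the tree's `exists_isArithFrobAt_mul_inv_mem_not_mem`, Weil pairing, complex conjugation), so: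

  `maninFrameResidueProperR_of_kato_of_iharaSq : F″ → diamondRibet1997_iharaLemma_sq → ManinFrameResidueProperR`.

The crux of route `AdditiveKolyvaginRoad` thus depends on exactly TWO cite-only published facts: F″ =
`kato_neron_isIntegral_twistedSymbolSum_of_additive_five_le` (Kato 2004 + Kim–Nakamura 2020) and the three-copy Ihara
lemma `ModularForms.diamondRibet1997_iharaLemma_sq` (Diamond–Ribet 1997 Lemma 4.6; Darmon–Diamond–Taylor 1995 §4.5).
The item is NOT closed by this (conditional-result).

References: [Kato2004Asterisque] (8.1.3), Thm. 9.7, Thm. 6.6; [KimNakamura2020] Cor. 2.4; [DiamondRibet1997] Lemma 4.6;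
[DarmonDiamondTaylor1995] §4.5 p. 137.
-/

set_option autoImplicit false
-- the Theorems directory repeats the summit name (sibling precedent `SignedBaseChangeAssembly.lean`)
set_option linter.dupNamespace false

noncomputable section

open scoped Classical MatrixGroups

open WeierstrassCurve NumberField Literature.NumberTheory.EllipticCurves
  Literature.NumberTheory.EllipticCurves.ModularForms
  Literature.NumberTheory.EllipticCurves.Rank1Residual
  Summit.BirchSwinnertonDyer.BirchSwinnertonDyer.Theorems
  Summit.BirchSwinnertonDyer.BirchSwinnertonDyer.Theses.AdditiveKolyvaginRoad

namespace Summit.BirchSwinnertonDyer.BirchSwinnertonDyer.Theorems.ManinFrameResidueProperROfKatoLTwist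

/-- **Crux `ManinFrameResidueProperR` (stmt-BirchSwinnertonDyer-20709) BY NAME, GRANTED ONLY F″ (`hK`, Kato's
zeta-element integrality in Néron units) and the three-copy Ihara lemma (`hI`, cite-only).** One line over
`maninFrameResidueProperR_of_kato_of_iharaSq_of_witness` with the Chebotarev witness supplied by the theorem
`NonEisensteinWitness.lTwistWitness`. CONDITIONAL; the item is not closed by this; BSD is not proved by this.
[cite: Kato2004Asterisque, (8.1.3) (p. 180), Thm. 9.7 (p. 189)] [cite: DiamondRibet1997, §4.4 Lemma 4.6]
[cite: DarmonDiamondTaylor1995, §4.5 p. 137] -/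
theorem maninFrameResidueProperR_of_kato_of_iharaSq
    (hK : kato_neron_isIntegral_twistedSymbolSum_of_additive_five_le)
    (hI : diamondRibet1997_iharaLemma_sq) : ManinFrameResidueProperR :=
  maninFrameResidueProperR_of_kato_of_iharaSq_of_witness hK hI NonEisensteinWitness.lTwistWitness

end Summit.BirchSwinnertonDyer.BirchSwinnertonDyer.Theorems.ManinFrameResidueProperROfKatoLTwist

end
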